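import Summits.AtomisticToContinuum.FouriersLaw.Theses.CoercivePulse
import Summits.AtomisticToContinuum.FouriersLaw.Theorems.CoercivePulseLinearSpreadOfBridge
import Summits.AtomisticToContinuum.FouriersLaw.Theorems.CoercivePulseLinearSpreadConverseOfBridge
import Summits.AtomisticToContinuum.FouriersLaw.Theorems.CoercivePulseFouriersLawOfBridge
import HarnessLib

/-!
# Strategist s3 (instance CoercivePulse) — the CP cone of `ConductanceLowerBound`, kernel-checked
(crux `ConductanceLowerBound` = stmt-AtomisticToContinuum-11749, bet route route-AtomisticToContinuum-CoercivePulse;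
companion of `Cruxes/ConductanceLowerBound/STRATEGY-CENSUS-s3-CP.md`; imports ONLY landed Theorems; no sorry, no new defs.)

WHAT THIS RECORDS.  On route CoercivePulse the positivity child CLB (stmt-11749, rank 502) and the route's rank-2 bet
`LinearSpread` (stmt-15382) are, MODULO the shared sibling (R) = `UniformAbelianRegularity` (stmt-13416), the SAME statement,
and each is then equivalent to the summit conjunct `FouriersLaw`:

* `clb_iff_linearSpread_of_regularity   : (R) → (CLB ↔ LinearSpread)`  — `→` is `linearSpread_of_bridge` (p167884, lead of
  stmt-15382, line KaramataCollapse), `←` is `conductanceLowerBound_of_linearSpread_of_regularity` (same lead; the bridges of line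
  abel-floor-exchange of stmt-11749 with `SymmetricSetup`/`PulseCalculus` discharged);
* `clb_iff_fouriersLaw_of_regularity    : (R) → (CLB ↔ FouriersLaw)`   — `→` is `fouriersLaw_of_bridge` (p167957), `←` is the
  corollary direction (`conductanceLowerBound_of_fouriersLaw`, re-proved here for the CP copy: limit uniqueness on `𝓝[≠] 0`);
* `linearSpread_iff_fouriersLaw_of_regularity`.

CONSEQUENCE (the census's Decomposition / bottom line).  The live skeleton of stmt-15382 (`Cruxes/LinearSpread/Lines/KaramataCollapse.lean`)
has as its ONLY open stubs the two items (R) and CLB; the live skeleton of stmt-11749 (`Lines/abel_floor_exchange.lean` v3.1) has the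
bulk stub (A⁻⁻) whose only CoercivePulse supplier is `LinearSpread` (p157637) and the exchange stub (R⁻) ⊂ (R).  The two leads
therefore delegate the SAME open content — "the shift-invariant Gibbs bulk is not an Abel insulator" (W⁻) — to each other; modulo (R)
no crux-level statement strictly between CLB and the summit exists on this route (`clb_iff_fouriersLaw_of_regularity`).
[cite: BonettoLebowitzReyBellet2000, §7] [cite: KunduDharNarayan2009, p. 3]
-/

namespace Summit.AtomisticToContinuum.FouriersLaw.Cruxes.ConductanceLowerBound.StrategistS3CP

open Filter Topology
open Summit.AtomisticToContinuum.FouriersLaw.Theses.CoercivePulse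
open Summit.AtomisticToContinuum.FouriersLaw.Theorems.LinearSpread.KaramataCollapse

/-- `FouriersLaw → CoercivePulse.ConductanceLowerBound`: the crux is a corollary of the conjunct (limit uniqueness on
`𝓝[≠] 0`, then `D_N → κ T > 0` gives `D_N ≥ κ T / 2` eventually). Twin of `Disproof.of_fouriersLaw` for the CP copy.
[cite: BonettoLebowitzReyBellet2000, §7] -/
theorem conductanceLowerBound_of_fouriersLaw (h : _root_.FouriersLaw) : ConductanceLowerBound := by
  intro ω₂ lam β γ hω hl hβ hγ _ μ hμ T hT D hD
  obtain ⟨-, κ, hκpos, hκ⟩ := h ω₂ lam β γ hω hl hβ hγ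
  obtain ⟨D', hD', hlim⟩ := hκ μ hμ T hT
  have hDD' : D = D' := funext fun N => tendsto_nhds_unique (hD N) (hD' N)
  subst hDD'
  have hκT : 0 < κ T := hκpos T hT
  have hev : ∀ᶠ N in atTop, κ T / 2 < D N := hlim.eventually_const_lt (by linarith)
  obtain ⟨N₁, hN₁⟩ := eventually_atTop.mp hev
  exact ⟨κ T / 2, by linarith, N₁, fun N hN => (hN₁ N hN).le⟩

/-- **F3a.** Modulo (R), the positivity child CLB and the route's rank-2 bet `LinearSpread` are equivalent (both directions landed,
no further hypothesis). [cite: KunduDharNarayan2009, p. 3] -/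
theorem clb_iff_linearSpread_of_regularity (hR : UniformAbelianRegularity) : ConductanceLowerBound ↔ LinearSpread :=
  ⟨linearSpread_of_bridge hR, fun hLS => conductanceLowerBound_of_linearSpread_of_regularity hLS hR⟩

/-- **F3b.** Modulo (R), CLB is equivalent to the summit conjunct. [cite: BonettoLebowitzReyBellet2000, §7] -/
theorem clb_iff_fouriersLaw_of_regularity (hR : UniformAbelianRegularity) : ConductanceLowerBound ↔ _root_.FouriersLaw :=
  ⟨fouriersLaw_of_bridge hR, conductanceLowerBound_of_fouriersLaw⟩

/-- **F3c.** Modulo (R), `LinearSpread` is equivalent to the summit conjunct. [cite: BonettoLebowitzReyBellet2000, §7] -/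
theorem linearSpread_iff_fouriersLaw_of_regularity (hR : UniformAbelianRegularity) : LinearSpread ↔ _root_.FouriersLaw :=
  ⟨fun h => fouriersLaw_of_linearSpread_of_regularity h hR,
    fun h => linearSpread_of_bridge hR (conductanceLowerBound_of_fouriersLaw h)⟩

/-- **The mutual redirect composed is the identity** (documentation theorem): CLB ⟶ LinearSpread (skeleton KaramataCollapse of
stmt-15382) ⟶ CLB (skeleton abel-floor-exchange of stmt-11749 fed by p157637) returns its input; neither leg touches W⁻.
[cite: KunduDharNarayan2009, p. 3] -/
theorem redirect_roundtrip (hR : UniformAbelianRegularity) (hC : ConductanceLowerBound) : ConductanceLowerBound :=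
  conductanceLowerBound_of_linearSpread_of_regularity (linearSpread_of_bridge hR hC) hR

end Summit.AtomisticToContinuum.FouriersLaw.Cruxes.ConductanceLowerBound.StrategistS3CP
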